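import Literature.NumberTheory.LFunctions.Xiao2020.KeiperLiTaylor
import Literature.NumberTheory.LFunctions.ZetaFirstZeroCertificate
import Mathlib.Analysis.Complex.Liouville
import HarnessLib

/-!
# RH-FREE: the law of the Taylor coefficients of `ζ₁'/ζ₁` at `s = 1` (Bombieri–Lagarias' `η_j`)

Topic `Literature/NumberTheory/LFunctions` (siblings: `Xiao2020/KeiperLiTaylor.lean` — the coefficients
`q_j = (ζ₁'/ζ₁)^{(j)}(1)/j!` (`zetaOneLogDerivCoeff`), `ζ₁(s) = (s−1)ζ(s)`, and the identity
`(k+1)a_{k+1} = q_k + (−1)^k(1 − (1−2^{−k−1})ζ(k+1))`, `a_k` the Taylor coefficients of `log ξ` at `1`;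
`KeiperLiTrend.lean` — the trend of the Keiper–Li coefficients; `ZetaFirstZeroCertificate.lean` — no
zeros of `ζ` with `0 < Im s ≤ 14`, a kernel certificate).  Everything here is PROVED; no definitions,
no named facts, and no hypothesis on the zeros of `ζ` beyond the certified `N(14) = 0` (**RH-FREE**).

Bombieri–Lagarias' / Coffey's coefficients `η_j` of `−ζ'/ζ(s) = 1/(s−1) + Σ_j η_j (s−1)^j` are
`η_j = −q_j`; they carry the "oscillating part" `S_n = −Σ_{j=1}^{n} C(n,j) η_{j−1}` of the Keiper–Li
coefficients.  Coffey (2010, remark after eq. (3)): "the radius of convergence of the expansion (3) is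
`3`, as the first singularity encountered is the trivial zero of `ζ(s)` at `s = −2`."  The precise law
behind this remark, proved here:

* `norm_zetaOneLogDerivCoeff_sub_trivial_le` — there is `C` with, for all `k ≥ 1`,

    `‖ q_k − (−1)^k ((1 − 2^{−(k+1)}) ζ(k+1) − 1) ‖ ≤ C · 13^{−k}`,

  i.e. `η_k = (−1)^{k+1} Σ_{m odd ≥ 3} m^{−(k+1)} + O(13^{−k})` — the trivial zeros `−2, −4, …` of `ζ`
  (the poles `1/(s+2), 1/(s+4), …` of `ζ'/ζ`, at distances `3, 5, …` from `s = 1`) give the whole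
  coefficient up to an error governed by the first non-trivial zero (`|ρ − 1| > 14`).

* `eventually_sign_zetaOneLogDerivCoeff` — consequently the `η_k` ALTERNATE IN SIGN for all large `k`
  (`(−1)^k Re q_k > 0` for `k ≥ K`): the first clause of Coffey's Conjecture 1 (Coffey 2005) holds
  eventually, unconditionally (threshold ineffective here).

Proof: by `Xiao2020.logXiTaylorCoeff_succ` the difference is `(k+1)a_{k+1} = (ξ'/ξ)^{(k)}(1)/k!`, a
Taylor coefficient of `ξ'/ξ`, which is holomorphic on the disc `|s − 1| < 14` (a zero of `ξ` is a
non-trivial zero of `ζ`, and those have `|Im ρ| > 14` by the certificate `zetaZeroCount_fourteen`);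
Cauchy's estimate on the circle `|s − 1| = 13`.

## References

* M. W. Coffey, *The Stieltjes constants, their relation to the `η_j` coefficients, and representation
  of the Hurwitz zeta function*, Analysis 30 (2010), 383–409, eqs. (3)–(5) and the remark following
  (5) (arXiv:0706.0343, held: `paper:arxiv-0706.0343`, p. 2). [Coffey2010Eta]
* E. Bombieri, J. C. Lagarias, *Complements to Li's criterion for the Riemann hypothesis*, J. Number
  Theory 77 (1999), 274–287, Thm. 2. [BombieriLagarias1999]
* H. M. Edwards, *Riemann's Zeta Function* (1974), §6.6 (`N(14) = 0`). [Edwards1974]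
-/

noncomputable section

open Complex Filter Topology Set Metric Finset
open scoped Nat

namespace Literature.NumberTheory.LFunctions

/-- `ξ` has no zeros in the disc `|s − 1| < 14`: a zero of `ξ` is a non-trivial zero of `ζ` off
the real axis (`riemannXi_zero_prop`), and `ζ` has no zeros with `0 < |Im s| ≤ 14`
(`riemannZeta_ne_zero_of_im_pos_of_im_le_fourteen`, conjugation). [folklore] -/
private theorem riemannXi_ne_zero_of_mem_ball {s : ℂ} (hs : s ∈ ball (1 : ℂ) 14) : riemannXi s ≠ 0 := by
  intro h
  obtain ⟨hζ, -, -, him⟩ := riemannXi_zero_prop h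
  have hdist : ‖s - 1‖ < 14 := by rwa [mem_ball, dist_eq_norm] at hs
  have habs : |s.im| < 14 := by
    have := abs_im_le_norm (s - 1)
    simp only [sub_im, one_im, sub_zero] at this
    linarith
  rcases lt_or_gt_of_ne him with hneg | hpos
  · have h1 : riemannZeta (starRingEnd ℂ s) = 0 := by rw [riemannZeta_conj, hζ, map_zero]
    refine riemannZeta_ne_zero_of_im_pos_of_im_le_fourteen (s := starRingEnd ℂ s) ?_ ?_ h1
    · simp only [conj_im]; linarith
    · simp only [conj_im]; rw [abs_of_neg hneg] at habs; linarith
  · exact riemannZeta_ne_zero_of_im_pos_of_im_le_fourteen hpos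
      (by rw [abs_of_pos hpos] at habs; exact habs.le) hζ

/-- `ξ'/ξ` is holomorphic on the disc `|s − 1| < 14`. [folklore] -/
private theorem differentiableOn_logDeriv_riemannXi_ball :
    DifferentiableOn ℂ (logDeriv riemannXi) (ball (1 : ℂ) 14) := by
  intro s hs
  have h1 : DifferentiableAt ℂ (deriv riemannXi) s :=
    (differentiable_riemannXi.contDiff (n := 2)).differentiable_deriv_two.differentiableAt
  have h2 : DifferentiableAt ℂ riemannXi s := differentiable_riemannXi s
  have h : DifferentiableAt ℂ (fun z ↦ deriv riemannXi z / riemannXi z) s :=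
    h1.div h2 (riemannXi_ne_zero_of_mem_ball hs)
  have heq : logDeriv riemannXi = fun z ↦ deriv riemannXi z / riemannXi z := by
    funext z; rw [logDeriv_apply]
  rw [heq]
  exact h.differentiableWithinAt

/-- **RH-FREE. The law of Bombieri–Lagarias' coefficients `η_k = −q_k`** (Coffey 2010, remark after
(5): the expansion `−ζ'/ζ(s) = 1/(s−1) + Σ η_j (s−1)^j` has radius `3`, the first singularity being
the trivial zero `s = −2`). Quantitatively: there is `C` such that for all `k ≥ 1`

  `‖ q_k − (−1)^k ((1 − 2^{−(k+1)}) ζ(k+1) − 1) ‖ ≤ C / 13^k`,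

`q_k = (ζ₁'/ζ₁)^{(k)}(1)/k!`; the main term `(−1)^k Σ_{m odd ≥ 3} m^{−(k+1)} ∼ (−1)^k 3^{−(k+1)}` is the
contribution of the trivial zeros, the error that of the non-trivial zeros (`|ρ − 1| > 14`, certified
`N(14) = 0`).
-- TODO(general form): the error is `O(r^{−k})` for every `r < |ρ₁ − 1| = |½ + iγ₁ − 1| ≈ 14.14`.
[cite: Coffey2010Eta, eqs. (3)–(5) and remark] -/
theorem norm_zetaOneLogDerivCoeff_sub_trivial_le :
    ∃ C : ℝ, ∀ k : ℕ, 1 ≤ k →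
      ‖Xiao2020.zetaOneLogDerivCoeff k -
          (-1) ^ k * ((1 - 1 / 2 ^ (k + 1)) * riemannZeta ((k + 1 : ℕ) : ℂ) - 1)‖ ≤ C / 13 ^ k := by
  -- a bound for `ξ'/ξ` on the circle `|s − 1| = 13`
  have hcont : ContinuousOn (logDeriv riemannXi) (sphere (1 : ℂ) 13) :=
    differentiableOn_logDeriv_riemannXi_ball.continuousOn.mono
      (sphere_subset_closedBall.trans (closedBall_subset_ball (by norm_num)))
  obtain ⟨M, hM⟩ := (isCompact_sphere (1 : ℂ) 13).exists_bound_of_continuousOn hcont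
  refine ⟨M, fun k hk ↦ ?_⟩
  -- the difference is `(k+1) a_{k+1} = (ξ'/ξ)^{(k)}(1)/k!`
  have hsucc := Xiao2020.logXiTaylorCoeff_succ hk
  have hid : Xiao2020.zetaOneLogDerivCoeff k -
      (-1) ^ k * ((1 - 1 / 2 ^ (k + 1)) * riemannZeta ((k + 1 : ℕ) : ℂ) - 1) =
      ((k : ℂ) + 1) * Xiao2020.logXiTaylorCoeff (k + 1) := by
    rw [hsucc]; ring
  have hfk : (k ! : ℂ) ≠ 0 := by exact_mod_cast Nat.factorial_ne_zero k
  have ha : ((k : ℂ) + 1) * Xiao2020.logXiTaylorCoeff (k + 1) =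
      iteratedDeriv k (logDeriv riemannXi) 1 / (k ! : ℂ) := by
    unfold Xiao2020.logXiTaylorCoeff
    rw [iteratedDeriv_succ_log_riemannXi_one, Nat.factorial_succ]
    push_cast
    field_simp
  rw [hid, ha, norm_div, Complex.norm_natCast]
  -- Cauchy's estimate on `|s − 1| = 13`
  have hdc : DiffContOnCl ℂ (logDeriv riemannXi) (ball (1 : ℂ) 13) :=
    (differentiableOn_logDeriv_riemannXi_ball.mono
      (closure_ball_subset_closedBall.trans (closedBall_subset_ball (by norm_num)))).diffContOnCl
  have hC := Complex.norm_iteratedDeriv_le_of_forall_mem_sphere_norm_le k (by norm_num : (0 : ℝ) < 13)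
    hdc hM
  have hfpos : (0 : ℝ) < k ! := by exact_mod_cast Nat.factorial_pos k
  rw [div_le_iff₀ hfpos]
  calc ‖iteratedDeriv k (logDeriv riemannXi) 1‖ ≤ k ! * M / 13 ^ k := hC
    _ = M / 13 ^ k * k ! := by ring

/-- The main term is the contribution of the trivial zeros: for `k ≥ 1`,
`(1 − 2^{−(k+1)}) ζ(k+1) − 1 = Σ_{j ≥ 0} (2j+3)^{−(k+1)}` (odd integers `≥ 3`). [folklore] -/
private theorem hasSum_inv_odd_pow_from_three {k : ℕ} (hk : 1 ≤ k) :
    HasSum (fun j : ℕ ↦ (((3 : ℂ) + 2 * (j : ℂ)) ^ (k + 1))⁻¹)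
      ((1 - 1 / 2 ^ (k + 1)) * riemannZeta ((k + 1 : ℕ) : ℂ) - 1) := by
  have h := Xiao2020.hasSum_inv_odd_pow (k := k + 1) (by omega)
  have h0 := (hasSum_nat_add_iff' 1).2 h
  simp only [Finset.range_one, Finset.sum_singleton, Nat.cast_zero, mul_zero, add_zero, one_pow,
    inv_one] at h0
  refine h0.congr_fun fun j ↦ ?_
  push_cast
  ring_nf

/-- **RH-FREE. `η_k` versus the trivial zeros**, series form: there is `C` with
`‖q_k − (−1)^k Σ_{j≥0} (2j+3)^{−(k+1)}‖ ≤ C/13^k` for all `k ≥ 1` — so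
`η_k = −q_k = (−1)^{k+1}(3^{−k−1} + 5^{−k−1} + 7^{−k−1} + ⋯) + O(13^{−k})`.
[cite: Coffey2010Eta, eqs. (3)–(5) and remark] -/
theorem norm_zetaOneLogDerivCoeff_sub_tsum_le :
    ∃ C : ℝ, ∀ k : ℕ, 1 ≤ k →
      ‖Xiao2020.zetaOneLogDerivCoeff k -
          (-1) ^ k * ∑' j : ℕ, (((3 : ℂ) + 2 * (j : ℂ)) ^ (k + 1))⁻¹‖ ≤ C / 13 ^ k := by
  obtain ⟨C, hC⟩ := norm_zetaOneLogDerivCoeff_sub_trivial_le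
  refine ⟨C, fun k hk ↦ ?_⟩
  rw [(hasSum_inv_odd_pow_from_three hk).tsum_eq]
  exact hC k hk

/-! ### Sign alternation of `η_k` for large `k` (Coffey's Conjecture 1, eventually) -/

/-- The real part of the trivial-zero series: `Re Σ_{j≥0} (2j+3)^{−(k+1)} ≥ 3^{−(k+1)}` for `k ≥ 1`
(the series has non-negative real terms; keep the first). [folklore] -/
private theorem inv_three_pow_le_re_tsum {k : ℕ} (hk : 1 ≤ k) :
    (3 ^ (k + 1) : ℝ)⁻¹ ≤ (∑' j : ℕ, (((3 : ℂ) + 2 * (j : ℂ)) ^ (k + 1))⁻¹).re := by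
  have hs : Summable fun j : ℕ ↦ (((3 : ℂ) + 2 * (j : ℂ)) ^ (k + 1))⁻¹ :=
    (hasSum_inv_odd_pow_from_three hk).summable
  have hre := Complex.hasSum_re hs.hasSum
  have hterm : ∀ j : ℕ, ((((3 : ℂ) + 2 * (j : ℂ)) ^ (k + 1))⁻¹).re = ((3 + 2 * (j : ℝ)) ^ (k + 1))⁻¹ := by
    intro j
    rw [show (3 : ℂ) + 2 * (j : ℂ) = ((3 + 2 * (j : ℝ) : ℝ) : ℂ) by push_cast; ring, ← Complex.ofReal_pow,
      ← Complex.ofReal_inv, Complex.ofReal_re]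
  simp only [hterm] at hre
  have h0 := le_hasSum hre 0 fun j _ ↦ by positivity
  simpa using h0

/-- **RH-FREE. Sign alternation of Bombieri–Lagarias' `η_k` for all large `k`** (the first clause of
Coffey's Conjecture 1 — "the `η_j` alternate in sign" — holds from some `k` on, unconditionally): there
is `K` such that `(−1)^k Re q_k > 0`, i.e. `sign η_k = (−1)^{k+1}`, for all `k ≥ K`. From
`norm_zetaOneLogDerivCoeff_sub_tsum_le`: `(−1)^k Re q_k ≥ 3^{−(k+1)} − C 13^{−k} > 0` once `(13/3)^k > 3C`.
(The threshold `K` is ineffective here: `C` is a Cauchy bound for `ξ'/ξ` on `|s − 1| = 13`.)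
[cite: Coffey2010Eta, eqs. (3)–(5) and remark] -/
theorem eventually_sign_zetaOneLogDerivCoeff :
    ∃ K : ℕ, ∀ k : ℕ, K ≤ k → 0 < (-1 : ℝ) ^ k * (Xiao2020.zetaOneLogDerivCoeff k).re := by
  obtain ⟨C, hC⟩ := norm_zetaOneLogDerivCoeff_sub_tsum_le
  -- `(13/3)^k → ∞`: eventually `3 C < (13/3)^k`
  have hev : ∀ᶠ k : ℕ in atTop, 3 * C + 1 < ((13 : ℝ) / 3) ^ k :=
    (tendsto_pow_atTop_atTop_of_one_lt (by norm_num : (1 : ℝ) < 13 / 3)).eventually_gt_atTop _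
  obtain ⟨K₀, hK₀⟩ := Filter.eventually_atTop.1 hev
  refine ⟨max K₀ 1, fun k hk ↦ ?_⟩
  have hk1 : 1 ≤ k := le_of_max_le_right hk
  have hkK : K₀ ≤ k := le_of_max_le_left hk
  have h := hC k hk1
  set q := Xiao2020.zetaOneLogDerivCoeff k with hq
  set T := ∑' j : ℕ, (((3 : ℂ) + 2 * (j : ℂ)) ^ (k + 1))⁻¹ with hT
  -- real parts
  have hre : |q.re - (-1) ^ k * T.re| ≤ C / 13 ^ k := by
    have h1 := Complex.abs_re_le_norm (q - (-1) ^ k * T)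
    have h2 : (q - (-1) ^ k * T).re = q.re - (-1) ^ k * T.re := by
      rw [Complex.sub_re]
      congr 1
      rw [show ((-1 : ℂ) ^ k) = (((-1 : ℝ) ^ k : ℝ) : ℂ) by push_cast; ring, Complex.re_ofReal_mul]
    rw [h2] at h1
    exact h1.trans h
  have hT3 := inv_three_pow_le_re_tsum hk1
  have hsq : ((-1 : ℝ) ^ k) * ((-1 : ℝ) ^ k) = 1 := by
    rw [← mul_pow]; norm_num
  -- `(−1)^k Re q ≥ Re T − C/13^k`
  have hlow : T.re - C / 13 ^ k ≤ (-1 : ℝ) ^ k * q.re := by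
    have h3 := (abs_le.1 hre).1
    have h4 : (-1 : ℝ) ^ k * q.re - T.re = (-1 : ℝ) ^ k * (q.re - (-1) ^ k * T.re) := by
      linear_combination T.re * hsq
    rcases neg_one_pow_eq_or ℝ k with hp | hp
    · rw [hp] at h4 ⊢; rw [hp] at h3; linarith
    · rw [hp] at h4 ⊢; rw [hp] at h3
      have h5 := (abs_le.1 hre).2
      rw [hp] at h5
      linarith
  -- `3^{-(k+1)} − C/13^k > 0`
  have hpos : C / 13 ^ k < (3 ^ (k + 1) : ℝ)⁻¹ := by
    have h13 : (0 : ℝ) < 13 ^ k := by positivity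
    have h3k : (0 : ℝ) < 3 ^ k := by positivity
    have hK := hK₀ k hkK
    rw [div_pow] at hK
    have hK' : (3 * C + 1) * 3 ^ k < 13 ^ k := (lt_div_iff₀ h3k).1 hK
    rw [div_lt_iff₀ h13, pow_succ, inv_mul_eq_div, lt_div_iff₀ (by positivity)]
    nlinarith [hK', h3k]
  linarith

end Literature.NumberTheory.LFunctions
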